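import Literature.Computability.QuantumComplexity.PathModelTemperleyLieb
import Literature.Computability.QuantumComplexity.PathModelPositionEncoding
import Literature.Computability.QuantumComplexity.ReversibleCliffordT
import HarnessLib

/-!
# Qubits encoded in the AJL path model at `k = 5`: four strands per qubit

Topic `Literature/Computability/QuantumComplexity`; infrastructure for the `PromiseBQP`-hardness of
the Jones polynomial at `e^{2πi/5}` (`flw_jonesApproxProblem_hard`, `JonesInBQP.lean`), after
D. Aharonov, I. Arad, *The BQP-hardness of approximating the Jones polynomial*, New J. Phys. 13
(2011) 035019 = arXiv:quant-ph/0605181, §3.1 ("the 4-steps encoding"), and M. Freedman, M. Larsen,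
Z. Wang, Comm. Math. Phys. 227 (2002) 605 (the same encoding at level `3`, i.e. `k = 5`).

In the tree's path model (`PathModelRepresentation.lean`: a string of `n` step bits is a walk on
`G_5 = {1,2,3,4}` from vertex `1`; `Φ_i` acts on bits `i, i+1`) a qubit is a block of four strands
whose walk returns to vertex `1`: there are exactly two such walks, `1,2,1,2,1` (bits `1,0,1,0`,
encoding `|0⟩`) and `1,2,3,2,1` (bits `1,1,0,0`, encoding `|1⟩`) (Aharonov–Arad §3.1: "the state
`|0⟩` is encoded by the path `1→2→1→2→1` and `|1⟩` by `1→2→3→2→1`"). `N` qubits occupy `4N`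
strands, block `a` = strands `4a+1, …, 4a+4` = bits `4a, …, 4a+3`, and the all-zero register is
encoded by the zigzag string `α = 1,0,1,0,…` of the plat closure (`ajlAlpha`), so that
`⟨α|φ(b)|α⟩ = ⟨enc 0| φ(b) |enc 0⟩` is the quantity the Jones problem thresholds
(`ajlRatio_eq_norm`, `JonesLoopCount.lean`).

## Contents (all at `k = 5`)

* `encBit`, `encodeBits : QReg N → QReg (N * 4)` (the block code), its values, positions of the
  encoded walk (`pathPos_encodeBits_*`), validity (`isGkPath_encodeBits`), injectivity, and
  `encodeBits_zero : encodeBits 0 = ajlAlpha (N * 4)`;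
* `encIso N`, the isometry `|x⟩ ↦ |enc x⟩` as a `2^{4N} × 2^N` matrix: `encIsoᴴ encIso = 1`
  (`conjTranspose_encIso_mul_encIso`) and `(encIsoᴴ M encIso) x y = M (enc x) (enc y)`;
* `blockGen a r` (`r < 3`), the three braid generators inside block `a`, and the **one-qubit
  path-model matrices** `blockPhi r` (the `2 × 2` matrix of `Φ_{4a+r}` on the two code walks,
  AJL eq. (3.1) at the vertices `1, 2, 1`: `blockPhi 0 = blockPhi 2 = diag(λ₂/λ₁, 0)`,
  `blockPhi 1 = [[λ₁/λ₂, √(λ₃λ₁)/λ₂], [√(λ₃λ₁)/λ₂, λ₃/λ₂]]`, `λ_ℓ = sin(πℓ/5)`) and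
  `blockCrossing r ε = A^{±1} blockPhi r + A^{∓1} 1`;
* the **exact intertwining relations** (`ajlPhiC_blockGen_mul_encIso`,
  `ajlCrossingMatrix_blockGen_mul_encIso`):
  `Φ_{4a+r} · encIso = encIso · (blockPhi r on wire a)` and
  `ρ(σ_{4a+r}^ε) · encIso = encIso · (blockCrossing r ε on wire a)`: a braid generator inside a
  block acts on encoded states exactly as a one-qubit gate on that qubit, and does not lead out of
  the code space (Aharonov–Arad §3.1–§3.2, the tensor-product structure of the encoded
  representation restricted to in-block generators).

Design: the register has `N * 4` strands (so that bit `t` lies in block `t / 4` at offset `t % 4`);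
everything is stated with the tree's `placeGate (wireEmb a)` so that products of in-block
generators match the semantics `QCircuit.toMatrix` of one-qubit circuits (linearity of
`placeGate` from `PathModelPositionEncoding.lean`). The numerical values
`λ₂/λ₁ = 2cos(π/5)`, `λ₃ = λ₂` are not substituted here.

## References

* D. Aharonov, I. Arad, New J. Phys. 13 (2011) 035019; arXiv:quant-ph/0605181, §3.1 (4-steps
  encoding), §3.2 [AharonovArad2011].
* D. Aharonov, V. Jones, Z. Landau, Algorithmica 55 (2009); arXiv:quant-ph/0511096, §3.1
  eq. (3.1), §3.3 (`|α⟩`) [AharonovJonesLandau2009].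
* M. Freedman, M. Larsen, Z. Wang, Comm. Math. Phys. 227 (2002) 605–622 [FreedmanLarsenWang2002].
-/

noncomputable section

open Matrix Finset

namespace Literature.Computability.QuantumComplexity

open Cryptography

variable {N : ℕ}

/-! ### The block code -/

/-- The four step bits of the code walk of one qubit: `|0⟩ ↦ 1,0,1,0` (walk `1,2,1,2,1`),
`|1⟩ ↦ 1,1,0,0` (walk `1,2,3,2,1`); offset `r` of the bit within the block.
[cite: AharonovArad2011, §3.1] -/
def encBit (b : Bool) (r : Fin 4) : Bool :=
  match (r : ℕ) with
  | 0 => true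
  | 1 => b
  | 2 => !b
  | _ => false

/-- **The 4-steps encoding** of an `N`-qubit basis label as a string of `4N` step bits: bit `t`
is bit `t % 4` of the code of qubit `t / 4`. [cite: AharonovArad2011, §3.1] -/
def encodeBits (x : QReg N) : QReg (N * 4) := fun t =>
  encBit (x ⟨(t : ℕ) / 4, (Nat.div_lt_iff_lt_mul (by norm_num)).2 t.isLt⟩)
    ⟨(t : ℕ) % 4, Nat.mod_lt _ (by norm_num)⟩

/-- The encoding isometry `|x⟩ ↦ |enc x⟩` as a matrix `QReg (4N) × QReg N`.
[cite: AharonovArad2011, §3.1] -/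
def encIso (N : ℕ) : Matrix (QReg (N * 4)) (QReg N) ℂ :=
  Matrix.of fun p x => if p = encodeBits x then 1 else 0

/-- The braid generator `σ_{4a+r+1}` (0-indexed generator `4a + r`, acting on bits
`4a+r, 4a+r+1`), for `r < 3` the three generators inside block `a`. [cite: AharonovArad2011, §3.1] -/
def blockGen (a : Fin N) (r : Fin 3) : Fin (N * 4 - 1) :=
  ⟨4 * (a : ℕ) + r, by have := a.isLt; have := r.isLt; omega⟩

/-- **The one-qubit path-model generators at `k = 5`**: the `2 × 2` matrix of `Φ_{4a+r}` on the
code walks (`false` = `|0⟩ = 1,2,1,2,1`, `true` = `|1⟩ = 1,2,3,2,1`), read off AJL eq. (3.1):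
for `r = 0, 2` the generator sits at a vertex-`1` position and is `diag(λ₂/λ₁, 0)`; for `r = 1`
it sits at vertex `2` and is `[[λ₁/λ₂, √(λ₃λ₁)/λ₂], [√(λ₃λ₁)/λ₂, λ₃/λ₂]]` (`λ_ℓ = sin(πℓ/5)`).
[cite: AharonovJonesLandau2009, §3.1 eq. (3.1)] -/
def blockPhi (r : Fin 3) : Matrix (QReg 1) (QReg 1) ℝ :=
  if (r : ℕ) = 1 then
    Matrix.of fun y x =>
      if y 0 = x 0 then ajlWeight 5 (2 + stepSign (x 0)) / ajlWeight 5 2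
      else Real.sqrt (ajlWeight 5 3 * ajlWeight 5 1) / ajlWeight 5 2
  else Matrix.of fun y x => if x 0 = false ∧ y 0 = false then ajlWeight 5 2 / ajlWeight 5 1 else 0

/-- The one-qubit crossing gate `ρ(σ^ε) = A^{±1} blockPhi r + A^{∓1} 1` at `A = A_5`.
[cite: AharonovJonesLandau2009, Def. 2.6 and Def. 2.14] -/
def blockCrossing (r : Fin 3) (ε : Bool) : Matrix (QReg 1) (QReg 1) ℂ :=
  crossingWeight (ajlPoint 5) ε true • (blockPhi r).map ((↑) : ℝ → ℂ) +
    crossingWeight (ajlPoint 5) ε false • (1 : Matrix (QReg 1) (QReg 1) ℂ)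

/-! ### Values of the code -/

/-- Offset `0` of a code block is a step up. [cite: AharonovArad2011, §3.1] -/
theorem encBit_zero (b : Bool) (h : 0 < 4) : encBit b ⟨0, h⟩ = true := rfl

/-- Offset `1` of a code block is the encoded bit. [cite: AharonovArad2011, §3.1] -/
theorem encBit_one (b : Bool) (h : 1 < 4) : encBit b ⟨1, h⟩ = b := rfl

/-- Offset `2` of a code block is the negated bit. [cite: AharonovArad2011, §3.1] -/
theorem encBit_two (b : Bool) (h : 2 < 4) : encBit b ⟨2, h⟩ = !b := rfl

/-- Offset `3` of a code block is a step down. [cite: AharonovArad2011, §3.1] -/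
theorem encBit_three (b : Bool) (h : 3 < 4) : encBit b ⟨3, h⟩ = false := rfl

/-- Offset `0` (numeral form). [cite: AharonovArad2011, §3.1] -/
@[simp] theorem encBit_zero' (b : Bool) : encBit b 0 = true := rfl

/-- Offset `1` (numeral form). [cite: AharonovArad2011, §3.1] -/
@[simp] theorem encBit_one' (b : Bool) : encBit b 1 = b := rfl

/-- Offset `2` (numeral form). [cite: AharonovArad2011, §3.1] -/
@[simp] theorem encBit_two' (b : Bool) : encBit b 2 = !b := rfl

/-- Offset `3` (numeral form). [cite: AharonovArad2011, §3.1] -/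
@[simp] theorem encBit_three' (b : Bool) : encBit b 3 = false := rfl

/-- Bit `4a + r` of the code is offset `r` of the code of qubit `a`. [cite: AharonovArad2011, §3.1] -/
theorem encodeBits_apply (x : QReg N) (a : Fin N) {r : ℕ} (hr : r < 4) (t : Fin (N * 4))
    (ht : (t : ℕ) = 4 * a + r) : encodeBits x t = encBit (x a) ⟨r, hr⟩ := by
  unfold encodeBits
  have h1 : (⟨(t : ℕ) / 4, (Nat.div_lt_iff_lt_mul (by norm_num)).2 t.isLt⟩ : Fin N) = a :=
    Fin.ext (by simp only [ht]; omega)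
  have h2 : (⟨(t : ℕ) % 4, Nat.mod_lt _ (by norm_num)⟩ : Fin 4) = ⟨r, hr⟩ :=
    Fin.ext (by simp only [ht]; omega)
  rw [h1, h2]

/-- Steps of one block add up to zero: `+1 + ε(b) - ε(b) - 1 = 0`. [cite: AharonovArad2011, §3.1] -/
theorem stepSign_encBit_sum (b : Bool) :
    stepSign (encBit b ⟨0, by norm_num⟩) + stepSign (encBit b ⟨1, by norm_num⟩) +
      stepSign (encBit b ⟨2, by norm_num⟩) + stepSign (encBit b ⟨3, by norm_num⟩) = 0 := by
  rw [encBit_zero, encBit_one, encBit_two, encBit_three]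
  cases b <;> simp [stepSign]

/-- **Block boundaries are at vertex `1`**: after `4a` steps the code walk is at `1`.
[cite: AharonovArad2011, §3.1] -/
theorem pathPos_encodeBits_mul (x : QReg N) {a : ℕ} (ha : a ≤ N) :
    pathPos (encodeBits x) (4 * a) = 1 := by
  induction a with
  | zero => simp
  | succ a ih =>
    have haN : a < N := by omega
    have h0 : 4 * a < N * 4 := by omega
    have h1 : 4 * a + 1 < N * 4 := by omega
    have h2 : 4 * a + 2 < N * 4 := by omega
    have h3 : 4 * a + 3 < N * 4 := by omega
    have s4 : pathPos (encodeBits x) (4 * (a + 1)) =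
        pathPos (encodeBits x) (4 * a + 3) + stepSign (encodeBits x ⟨4 * a + 3, h3⟩) :=
      pathPos_succ _ h3
    have s3 : pathPos (encodeBits x) (4 * a + 3) =
        pathPos (encodeBits x) (4 * a + 2) + stepSign (encodeBits x ⟨4 * a + 2, h2⟩) :=
      pathPos_succ _ h2
    have s2 : pathPos (encodeBits x) (4 * a + 2) =
        pathPos (encodeBits x) (4 * a + 1) + stepSign (encodeBits x ⟨4 * a + 1, h1⟩) :=
      pathPos_succ _ h1
    have s1 : pathPos (encodeBits x) (4 * a + 1) =
        pathPos (encodeBits x) (4 * a) + stepSign (encodeBits x ⟨4 * a, h0⟩) :=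
      pathPos_succ _ h0
    rw [s4, s3, s2, s1, ih (by omega),
      encodeBits_apply x ⟨a, haN⟩ (r := 0) (by norm_num) _ rfl,
      encodeBits_apply x ⟨a, haN⟩ (r := 1) (by norm_num) _ rfl,
      encodeBits_apply x ⟨a, haN⟩ (r := 2) (by norm_num) _ rfl,
      encodeBits_apply x ⟨a, haN⟩ (r := 3) (by norm_num) _ rfl]
    have := stepSign_encBit_sum (x ⟨a, haN⟩)
    linarith

/-- Inside block `a` the code walk visits `2`, then `2 + ε(x_a)` (`1` or `3`), then `2`.
[cite: AharonovArad2011, §3.1] -/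
theorem pathPos_encodeBits_block (x : QReg N) (a : Fin N) :
    pathPos (encodeBits x) (4 * a + 1) = 2 ∧
      pathPos (encodeBits x) (4 * a + 2) = 2 + stepSign (x a) ∧
        pathPos (encodeBits x) (4 * a + 3) = 2 := by
  have h0 : 4 * (a : ℕ) < N * 4 := by have := a.isLt; omega
  have h1 : 4 * (a : ℕ) + 1 < N * 4 := by have := a.isLt; omega
  have h2 : 4 * (a : ℕ) + 2 < N * 4 := by have := a.isLt; omega
  have e1 : pathPos (encodeBits x) (4 * a + 1) = 2 := by
    rw [pathPos_succ _ h0, pathPos_encodeBits_mul x (le_of_lt a.isLt),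
      encodeBits_apply x a (r := 0) (by norm_num) _ rfl, encBit_zero]
    simp
  have e2 : pathPos (encodeBits x) (4 * a + 2) = 2 + stepSign (x a) := by
    have s : pathPos (encodeBits x) (4 * a + 2) =
        pathPos (encodeBits x) (4 * a + 1) + stepSign (encodeBits x ⟨4 * a + 1, h1⟩) :=
      pathPos_succ _ h1
    rw [s, e1, encodeBits_apply x a (r := 1) (by norm_num) _ rfl, encBit_one]
  refine ⟨e1, e2, ?_⟩
  have s : pathPos (encodeBits x) (4 * a + 3) =
      pathPos (encodeBits x) (4 * a + 2) + stepSign (encodeBits x ⟨4 * a + 2, h2⟩) :=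
    pathPos_succ _ h2
  rw [s, e2, encodeBits_apply x a (r := 2) (by norm_num) _ rfl, encBit_two, stepSign_not]
  ring

/-- **Code strings are walks of `P_{4N,5}`** (they stay within the vertices `1, 2, 3`).
[cite: AharonovArad2011, §3.1] -/
theorem isGkPath_encodeBits (x : QReg N) : IsGkPath 5 (N * 4) (encodeBits x) := by
  intro t ht
  obtain ⟨a, r, hr, rfl⟩ : ∃ a r : ℕ, r < 4 ∧ t = 4 * a + r := ⟨t / 4, t % 4, Nat.mod_lt _ (by norm_num), by omega⟩
  rcases Nat.eq_zero_or_pos r with rfl | hr0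
  · rw [add_zero, pathPos_encodeBits_mul x (by omega)]; norm_num
  · have ha : a < N := by omega
    obtain ⟨e1, e2, e3⟩ := pathPos_encodeBits_block x ⟨a, ha⟩
    interval_cases r
    · rw [e1]; norm_num
    · rw [e2]; cases x ⟨a, ha⟩ <;> simp
    · rw [e3]; norm_num

/-- The code is injective (bit `4a + 1` is `x_a`). [cite: AharonovArad2011, §3.1] -/
theorem encodeBits_injective : Function.Injective (encodeBits (N := N)) := by
  intro x y h
  funext a
  have h1 : 4 * (a : ℕ) + 1 < N * 4 := by have := a.isLt; omega
  have := congr_fun h ⟨4 * a + 1, h1⟩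
  rwa [encodeBits_apply x a (r := 1) (by norm_num) _ rfl, encodeBits_apply y a (r := 1) (by norm_num) _ rfl,
    encBit_one, encBit_one] at this

/-- **The all-zero register is encoded by the zigzag string `α = 1,0,1,0,…`** of the plat closure.
[cite: AharonovJonesLandau2009, §3.3] -/
theorem encodeBits_zero : encodeBits (fun _ : Fin N => false) = ajlAlpha (N * 4) := by
  funext t
  obtain ⟨a, r, hr, ht⟩ : ∃ a r : ℕ, r < 4 ∧ (t : ℕ) = 4 * a + r :=
    ⟨t / 4, t % 4, Nat.mod_lt _ (by norm_num), by omega⟩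
  have ha : a < N := by have := t.isLt; omega
  rw [encodeBits_apply _ ⟨a, ha⟩ hr t ht, ajlAlpha, ht]
  have h4 : Even (4 * a) := ⟨2 * a, by ring⟩
  have h41 : ¬ Even (4 * a + 1) := fun h => by rw [Nat.even_add_one] at h; exact h h4
  have h42 : Even (4 * a + 2) := by rw [Nat.even_add]; simpa using h4
  have h43 : ¬ Even (4 * a + 3) := fun h => by
    rw [show 4 * a + 3 = 4 * a + 2 + 1 by ring, Nat.even_add_one] at h; exact h h42
  interval_cases r
  · rw [encBit_zero, add_zero]; simpa using h4
  · rw [encBit_one]; simpa using h41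
  · rw [encBit_two]; simpa using h42
  · rw [encBit_three]; simpa using h43

/-! ### The encoding isometry -/

/-- Entries of `encIso` (definitional). [cite: AharonovArad2011, §3.1] -/
theorem encIso_apply (p : QReg (N * 4)) (x : QReg N) :
    encIso N p x = if p = encodeBits x then 1 else 0 := rfl

/-- The columns of `encIso` are the encoded basis states. [cite: AharonovArad2011, §3.1] -/
theorem col_encIso (x : QReg N) : (encIso N).col x = basisState (encodeBits x) := by
  ext p
  rw [Matrix.col_apply, encIso_apply, basisState_apply]

/-- `encIso` applied to a basis state is the encoded basis state. [cite: AharonovArad2011, §3.1] -/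
theorem encIso_mulVec_basisState (x : QReg N) :
    encIso N *ᵥ basisState x = basisState (encodeBits x) := by
  rw [basisState, Matrix.mulVec_single_one, col_encIso]

/-- **`encIso` is an isometry**: `encIsoᴴ encIso = 1`. [cite: AharonovArad2011, §3.1] -/
theorem conjTranspose_encIso_mul_encIso : (encIso N)ᴴ * encIso N = 1 := by
  ext x y
  rw [Matrix.mul_apply, Matrix.one_apply]
  simp only [conjTranspose_apply, encIso_apply, apply_ite (star : ℂ → ℂ), star_one, star_zero,
    ite_mul, one_mul, zero_mul]
  rw [Finset.sum_ite_eq' Finset.univ (encodeBits x)]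
  simp only [Finset.mem_univ, if_true]
  by_cases h : x = y
  · subst h; simp
  · rw [if_neg (fun e => h (encodeBits_injective e)), if_neg h]

/-- **Compression to the code space**: `(encIsoᴴ M encIso) x y = M (enc x) (enc y)`; in particular
`⟨0…0| encIsoᴴ φ(b) encIso |0…0⟩ = ⟨α|φ(b)|α⟩`. [cite: AharonovArad2011, §3.1] -/
theorem conjTranspose_encIso_mul_mul_encIso_apply (M : Matrix (QReg (N * 4)) (QReg (N * 4)) ℂ)
    (x y : QReg N) : ((encIso N)ᴴ * M * encIso N) x y = M (encodeBits x) (encodeBits y) := by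
  rw [Matrix.mul_assoc, Matrix.mul_apply]
  simp only [conjTranspose_apply, encIso_apply, apply_ite (star : ℂ → ℂ), star_one, star_zero,
    ite_mul, one_mul, zero_mul, Finset.sum_ite_eq', Finset.mem_univ, if_true]
  rw [Matrix.mul_apply]
  simp only [encIso_apply, mul_ite, mul_one, mul_zero, Finset.sum_ite_eq', Finset.mem_univ, if_true]

/-! ### In-block generators: bits and flips of the code -/

/-- The value of the in-block generator index. [folklore] -/
@[simp] theorem blockGen_val (a : Fin N) (r : Fin 3) : (blockGen a r : ℕ) = 4 * a + r := rfl

/-- The first bit of `σ_{4a+r}` in the code is offset `r` of the code of qubit `a`.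
[cite: AharonovArad2011, §3.1] -/
theorem encodeBits_genFst_blockGen (x : QReg N) (a : Fin N) (r : Fin 3) :
    encodeBits x (genFst (blockGen a r)) = encBit (x a) ⟨r, by have := r.isLt; omega⟩ :=
  encodeBits_apply x a _ _ rfl

/-- The second bit of `σ_{4a+r}` in the code is offset `r + 1` of the code of qubit `a`.
[cite: AharonovArad2011, §3.1] -/
theorem encodeBits_genSnd_blockGen (x : QReg N) (a : Fin N) (r : Fin 3) :
    encodeBits x (genSnd (blockGen a r)) = encBit (x a) ⟨r + 1, by have := r.isLt; omega⟩ :=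
  encodeBits_apply x a _ _ (by simp; ring)

/-- The vertex before the first bit of `σ_{4a+r}`: `1`, `2`, `2 + ε(x_a)` for `r = 0, 1, 2`.
[cite: AharonovArad2011, §3.1] -/
theorem pathPos_encodeBits_blockGen (x : QReg N) (a : Fin N) (r : Fin 3) :
    pathPos (encodeBits x) (blockGen a r) =
      if (r : ℕ) = 0 then 1 else if (r : ℕ) = 1 then 2 else 2 + stepSign (x a) := by
  obtain ⟨e1, e2, -⟩ := pathPos_encodeBits_block x a
  obtain ⟨r, hr⟩ := r
  rw [blockGen_val]
  interval_cases r
  · rw [if_pos rfl, add_zero, pathPos_encodeBits_mul x (le_of_lt a.isLt)]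
  · rw [if_neg (by norm_num), if_pos rfl, e1]
  · rw [if_neg (by norm_num), if_neg (by norm_num), e2]

/-- **Flipping the middle generator toggles the qubit**: the flip of the code of `x` at
`σ_{4a+1}` to `b, ¬b` is the code of `x` with `x_a := b`. [cite: AharonovArad2011, §3.1] -/
theorem flipTo_encodeBits_blockGen_one (x : QReg N) (a : Fin N) (b : Bool) :
    flipTo (encodeBits x) (blockGen a 1) b = encodeBits (Function.update x a b) := by
  funext t
  obtain ⟨a', r, hr, ht⟩ : ∃ a' r : ℕ, r < 4 ∧ (t : ℕ) = 4 * a' + r :=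
    ⟨t / 4, t % 4, Nat.mod_lt _ (by norm_num), by omega⟩
  have ha' : a' < N := by have := t.isLt; omega
  rw [encodeBits_apply _ ⟨a', ha'⟩ hr t ht]
  by_cases h1 : t = genFst (blockGen a 1)
  · have hv : (t : ℕ) = 4 * a + 1 := by rw [h1]; rfl
    have haa : a' = a := by omega
    have hr1 : r = 1 := by omega
    subst hr1
    rw [h1, flipTo_genFst]
    have : (⟨a', ha'⟩ : Fin N) = a := Fin.ext haa
    rw [this, Function.update_self, encBit_one]
  by_cases h2 : t = genSnd (blockGen a 1)
  · have hv : (t : ℕ) = 4 * a + 2 := by rw [h2]; rfl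
    have haa : a' = a := by omega
    have hr2 : r = 2 := by omega
    subst hr2
    rw [h2, flipTo_genSnd]
    have : (⟨a', ha'⟩ : Fin N) = a := Fin.ext haa
    rw [this, Function.update_self, encBit_two]
  rw [flipTo_of_ne _ _ _ h1 h2, encodeBits_apply x ⟨a', ha'⟩ hr t ht]
  by_cases haa : a' = a
  · -- same block, offset 0 or 3: the code bit does not depend on the qubit
    have hv1 : (t : ℕ) ≠ 4 * a + 1 := fun e => h1 (Fin.ext e)
    have hv2 : (t : ℕ) ≠ 4 * a + 2 := fun e => h2 (Fin.ext e)
    have hr03 : r = 0 ∨ r = 3 := by omega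
    rcases hr03 with rfl | rfl
    · rw [encBit_zero, encBit_zero]
    · rw [encBit_three, encBit_three]
  · rw [Function.update_of_ne (fun e => haa (congrArg Fin.val e))]

/-! ### Columns of `Φ_{4a+r}` on the code: the exact one-qubit action -/

/-- Complex columns of `Φ_i` from the real ones. [folklore] -/
theorem col_ajlPhiC {n k : ℕ} (i : Fin (n - 1)) (p : QReg n) :
    (ajlPhiC k n i).col p = fun q => (((ajlPhi k n i).col p q : ℝ) : ℂ) := by
  ext q; rfl

/-- The real-to-complex image of `D • e_p + C • e_q` (real coefficients). [folklore] -/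
theorem ofReal_comp_smul_single_add {n : ℕ} (D C : ℝ) (p q : QReg n) :
    (fun r => (((D • Pi.single p (1 : ℝ) + C • Pi.single q (1 : ℝ) : QReg n → ℝ) r : ℝ) : ℂ)) =
      (D : ℂ) • basisState p + (C : ℂ) • basisState q := by
  funext r
  simp only [Pi.add_apply, Pi.smul_apply, smul_eq_mul, basisState_apply, Pi.single_apply, mul_ite,
    mul_one, mul_zero]
  split_ifs <;> simp

/-- `λ₀ = 0` at `k = 5` (vertex `0` is off the graph). [cite: AharonovJonesLandau2009, §3.1] -/
theorem ajlWeight_five_zero : ajlWeight 5 0 = 0 := ajlWeight_of_not (by norm_num)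

/-- **The in-block generators act as one-qubit gates on the code (columns)**:
`Φ_{4a+r} |enc x⟩ = Σ_y (blockPhi r)_{y, x_a} |enc x[a ↦ y]⟩`.
[cite: AharonovArad2011, §3.1 and §3.2] -/
theorem ajlPhiC_blockGen_mulVec_basisState (x : QReg N) (a : Fin N) (r : Fin 3) :
    ajlPhiC 5 (N * 4) (blockGen a r) *ᵥ basisState (encodeBits x) =
      ((blockPhi r (fun _ => false) (fun _ => x a) : ℝ) : ℂ) •
          basisState (encodeBits (Function.update x a false)) +
        ((blockPhi r (fun _ => true) (fun _ => x a) : ℝ) : ℂ) •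
          basisState (encodeBits (Function.update x a true)) := by
  have hp := isGkPath_encodeBits x
  have hfst := encodeBits_genFst_blockGen x a r
  have hsnd := encodeBits_genSnd_blockGen x a r
  have hpos := pathPos_encodeBits_blockGen x a r
  rw [basisState, Matrix.mulVec_single_one, col_ajlPhiC]
  obtain ⟨r, hr⟩ := r
  simp only [blockPhi, Fin.val_mk]
  interval_cases r
  · -- `r = 0`: bits `1, x_a` at vertex `1`
    simp only [show (0 : ℕ) ≠ 1 from by norm_num, if_false]
    cases hxa : x a
    · have hc : encodeBits x (genSnd (blockGen a ⟨0, hr⟩)) = !encodeBits x (genFst (blockGen a ⟨0, hr⟩)) := by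
        rw [hfst, hsnd, hxa]; rfl
      have hupd : Function.update x a false = x := Function.update_eq_self_iff.2 hxa.symm
      rw [col_ajlPhi hp hc, hpos, if_pos rfl, hfst, ofReal_comp_smul_single_add, hupd, encBit_zero]
      simp [ajlWeight_five_zero]
    · have hc : encodeBits x (genSnd (blockGen a ⟨0, hr⟩)) = encodeBits x (genFst (blockGen a ⟨0, hr⟩)) := by
        rw [hfst, hsnd, hxa]; rfl
      rw [col_ajlPhi_eq_zero (Or.inr hc)]
      ext q; simp
  · -- `r = 1`: bits `x_a, ¬x_a` at vertex `2`
    simp only [if_true]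
    have hc : encodeBits x (genSnd (blockGen a ⟨1, hr⟩)) = !encodeBits x (genFst (blockGen a ⟨1, hr⟩)) := by
      rw [hfst, hsnd]; rfl
    rw [col_ajlPhi hp hc, hpos, if_neg (by norm_num), if_pos rfl, hfst, encBit_one,
      show (⟨1, hr⟩ : Fin 3) = 1 from rfl, flipTo_encodeBits_blockGen_one, ofReal_comp_smul_single_add]
    cases hxa : x a
    · have hupd : Function.update x a false = x := Function.update_eq_self_iff.2 hxa.symm
      rw [hupd]
      simp [show (2 : ℤ) - 1 = 1 by norm_num, show (2 : ℤ) + 1 = 3 by norm_num]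
    · have hupd : Function.update x a true = x := Function.update_eq_self_iff.2 hxa.symm
      rw [hupd, add_comm]
      simp [show (2 : ℤ) - 1 = 1 by norm_num, show (2 : ℤ) + 1 = 3 by norm_num]
  · -- `r = 2`: bits `¬x_a, 0` at vertex `2 + ε(x_a)`
    simp only [show (2 : ℕ) ≠ 1 from by norm_num, if_false]
    cases hxa : x a
    · -- `|0⟩`: bits `1, 0` at vertex `1`
      have hc : encodeBits x (genSnd (blockGen a ⟨2, hr⟩)) = !encodeBits x (genFst (blockGen a ⟨2, hr⟩)) := by
        rw [hfst, hsnd, hxa]; rfl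
      have hupd : Function.update x a false = x := Function.update_eq_self_iff.2 hxa.symm
      rw [col_ajlPhi hp hc, hpos, if_neg (by norm_num), if_neg (by norm_num), hfst, hxa,
        ofReal_comp_smul_single_add, hupd, encBit_two]
      simp [ajlWeight_five_zero, show (2 : ℤ) + -1 = 1 by norm_num]
    · -- `|1⟩`: bits `0, 0`: the column vanishes
      have hc : encodeBits x (genSnd (blockGen a ⟨2, hr⟩)) = encodeBits x (genFst (blockGen a ⟨2, hr⟩)) := by
        rw [hfst, hsnd, hxa]; rfl
      rw [col_ajlPhi_eq_zero (Or.inr hc)]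
      ext q; simp

/-- **Exact intertwining for `Φ`**: `Φ_{4a+r} · encIso = encIso · placeGate (wire a) (blockPhi r)`.
[cite: AharonovArad2011, §3.1 and §3.2] -/
theorem ajlPhiC_blockGen_mul_encIso (a : Fin N) (r : Fin 3) :
    ajlPhiC 5 (N * 4) (blockGen a r) * encIso N =
      encIso N * placeGate (wireEmb a) ((blockPhi r).map ((↑) : ℝ → ℂ)) := by
  refine Matrix.ext fun p x => ?_
  have hl : (ajlPhiC 5 (N * 4) (blockGen a r) * encIso N).col x =
      (encIso N * placeGate (wireEmb a) ((blockPhi r).map ((↑) : ℝ → ℂ))).col x := by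
    rw [show (ajlPhiC 5 (N * 4) (blockGen a r) * encIso N).col x =
        ajlPhiC 5 (N * 4) (blockGen a r) *ᵥ (encIso N).col x from by
          ext q; simp [Matrix.mul_apply, Matrix.mulVec, dotProduct],
      show (encIso N * placeGate (wireEmb a) ((blockPhi r).map ((↑) : ℝ → ℂ))).col x =
        encIso N *ᵥ (placeGate (wireEmb a) ((blockPhi r).map ((↑) : ℝ → ℂ))).col x from by
          ext q; simp [Matrix.mul_apply, Matrix.mulVec, dotProduct],
      col_encIso, ajlPhiC_blockGen_mulVec_basisState,
      show (placeGate (wireEmb a) ((blockPhi r).map ((↑) : ℝ → ℂ))).col x =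
        placeGate (wireEmb a) ((blockPhi r).map ((↑) : ℝ → ℂ)) *ᵥ basisState x from by
          rw [basisState, Matrix.mulVec_single_one],
      placeGate_wireEmb_mulVec_basisState, mulVec_add, mulVec_smul, mulVec_smul,
      encIso_mulVec_basisState, encIso_mulVec_basisState]
    rfl
  exact congr_fun hl p

/-- **Exact intertwining for a crossing**: `ρ(σ_{4a+r}^ε) · encIso = encIso · placeGate (wire a)
(blockCrossing r ε)` — an in-block braid generator is exactly a one-qubit gate on the code.
[cite: AharonovArad2011, §3.1 and §3.2] -/
theorem ajlCrossingMatrix_blockGen_mul_encIso (a : Fin N) (r : Fin 3) (ε : Bool) :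
    ajlCrossingMatrix 5 (blockGen a r, ε) * encIso N =
      encIso N * placeGate (wireEmb a) (blockCrossing r ε) := by
  change (crossingWeight (ajlPoint 5) ε true • ajlPhiC 5 (N * 4) (blockGen a r) +
      crossingWeight (ajlPoint 5) ε false • (1 : Matrix _ _ ℂ)) * encIso N =
    encIso N * placeGate (wireEmb a) (crossingWeight (ajlPoint 5) ε true • (blockPhi r).map ((↑) : ℝ → ℂ) +
      crossingWeight (ajlPoint 5) ε false • 1)
  rw [Matrix.add_mul, Matrix.smul_mul, Matrix.smul_mul, Matrix.one_mul, ajlPhiC_blockGen_mul_encIso,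
    placeGate_add', placeGate_smul', placeGate_smul', placeGate_one, Matrix.mul_add,
    Matrix.mul_smul, Matrix.mul_smul, Matrix.mul_one]

end Literature.Computability.QuantumComplexity

end
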